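import Mathlib
import Literature.MathematicalPhysics.QuantumFieldTheory.Balaban1983to89.B7Eq31BCH

/-!
# `Balaban1983to89.B14.Eq372ContourBCH` — [Balaban1988Convergent] (3.71)–(3.72) p. 284: the contour variable
# `B(Γ) = Σ_{b⊂Γ} B(b)` and the second-order Baker–Campbell–Hausdorff expansion of the logarithm of the ordered product
# of bond exponentials along a contour, `(1/i) log(exp iB)(Γ) = B(Γ) + ½ Σ_{b<b′⊂Γ} i[B(b), B(b′)] + O(1)(Σ_b |B(b)|)³`,
# PROVED with an explicit `O(1)` in every complete normed `ℂ`-algebra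

statement-level skeleton of published theorems with citation tags; proofs where landed; nothing here is a
claim about the Yang–Mills mass gap

PDF held: `paper:balaban1988-cmp119-convergent-renormalization` (journal page = PDF page + 242); (3.68)–(3.72) read on the
x2 render `…-p042-x2.png` (p. 284) of
`run/shared/lean/pub/pub-balaban/b2b-balaban-ref1/pages/1988-cmp119-convergent-renormalization/`.

CITATION HEADER (lean-in-tree rule).  Source: T. Bałaban, *Convergent renormalization expansions for lattice gauge
theories*, Commun. Math. Phys. **119**, 243–285 (1988), doi:10.1007/bf01217741 [Balaban1988Convergent] (cell paper B14 =
"[III]").  Mega-formalization `lit-balaban` (HOME `run/shared/lean/pub/lit-balaban/`), reader/typer unit `lit-balaban-r11`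
(generation 3), SKELETON row **B14.Claim@283alt** (second proof of Theorem 2, pp. 283–284: (3.68) typed with its erratum
in `…B14Sect3`; the sketch displays (3.69)–(3.72) were absent) — this file types (3.71) and PROVES the expansion (3.72).

THE PRINTED TEXT (verbatim, p. 284 [PDF 42]).  *"… and  B′(b) = (1/i) log Ū^j_k(Γ_{z,b₋} ∪ b ∪ Γ_{b₊,z}) .   (3.71)
Now we take the cube □₁ ∈ π_n containing z, and we repeat the construction before (3.68), but for the representation
U_k = U_{n,□₁̃}(M˙(U_k)). We write U_k = (exp iL⁻ⁿ𝐇_{n,□₁̃}(1/i) log M˙(U_k))^{u_k^{−1}}, and using the gauge invariance of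
the trace in (3.70) we can replace the variables B′ by
  (1/i) log(exp iQ_j(L⁻ⁿ𝐇_{n,□₁̃}))(Γ) = (1/i) log(exp iB)(Γ)
     = B(Γ) + ½ Σ_{b,b′⊂Γ, b<b′} i[B(b), B(b′)] + O(1)(LʲL⁻ⁿ)³   (3.72)
where Γ = Γ_{z,b₋} ∪ b ∪ Γ_{b₊,z}. The contour variable B(Γ) is represented as (∂B)(Σ), where Σ is a minimal surface with
the boundary Γ. This assures that both terms on the right-hand side above are of the order O((LʲL⁻ⁿ)²)."*

THE MODEL.  A contour `Γ` is an ordered list of bonds; the configuration `exp iB` assigns to the bond `b` the group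
element `exp(iB(b))`, `B(b)` in a complete normed `ℂ`-algebra `𝔸` (the Lie algebra in a matrix realisation; the
orientation signs of `B(b)` along `Γ` are absorbed in the list entries); `(exp iB)(Γ)` is the ORDERED PRODUCT of the
bond variables along `Γ` (`holonomy`), `B(Γ) = Σ_{b⊂Γ} B(b)` (`contourVar`, **(3.71)**'s contour variable read
additively), `Σ_{b<b′⊂Γ}[X_b, X_{b′}]` in contour order is `pairComm`, and `log` is the series (21) of [Balaban1985Averaging]
near `1` (the tree's `MatrixLog.mlog`).  The printed `O(1)(LʲL⁻ⁿ)³` is the cube of the total size `Σ_b |B(b)|` of the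
contour variables (each `|B(b)| = O(LʲL⁻ⁿ·…)` by (3.68), `|Γ|` bounded); here the remainder is bounded by an EXPLICIT
absolute constant times `(Σ_{b⊂Γ} ‖X_b‖)³` on the ball `Σ_b ‖X_b‖ ≤ 1/20`.

WHAT IS PROVED (kernel-checked, 0 sorry; `𝔸` any complete normed `ℂ`-algebra):
* `norm_contourVar_le`, `norm_pairComm_le` (`‖Σ_{b<b′}[X_b,X_{b′}]‖ ≤ (Σ‖X_b‖)²`), `norm_holonomy_sub_one_le`
  (`‖Π_b e^{X_b} − 1‖ ≤ e^{Σ‖X_b‖} − 1`);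
* **`norm_mlog_holonomy_sub_le`** — the second-order BCH expansion for an ordered product of ANY number of exponentials:
  `‖log(Π_{b⊂Γ} e^{X_b}) − Σ_b X_b − ½ Σ_{b<b′}[X_b, X_{b′}]‖ ≤ 28 (Σ_b ‖X_b‖)³` whenever `Σ_b ‖X_b‖ ≤ 1/20` — by
  induction along the contour from the tree's two-factor estimate (30) of [Balaban1985Averaging] with explicit constant
  (`B7Eq31BCH.eq30_of_sum_le`: `‖log(e^Xe^Y) − X − Y − ½[X,Y]‖ ≤ 5(‖X‖²‖Y‖ + ‖X‖‖Y‖²)` on `‖X‖ + ‖Y‖ ≤ 1/5`), the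
  logarithm bound (26) (`MatrixLog.norm_mlog_le_two_mul`) and `e^s − 1 ≤ 2s` (`Real.abs_exp_sub_one_le`);
* **`eq372`** — (3.72) in the printed letters: with `X_b = iB(b)`,
  `‖(1/i) log(Π_b e^{iB(b)}) − (B(Γ) + ½ Σ_{b<b′} i[B(b), B(b′)])‖ ≤ 28 (Σ_b ‖B(b)‖)³` on `Σ_b ‖B(b)‖ ≤ 1/20`.
NOT HERE: the first equality of (3.72) (gauge invariance of the trace, replacing `B′` by the `Q_j(L⁻ⁿ𝐇)`-variables);
the Stokes representation `B(Γ) = (∂B)(Σ)` and the orders `O((LʲL⁻ⁿ)²)`; (3.69)–(3.70); the axial-gauge contours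
`Γ_{z,x}` of Sect. F [15] (tree: `B11.SectFPrinted`, `T4TermwiseBCH.transporter_mem`).  No `sorry`.
-/

noncomputable section

open NormedSpace

namespace Literature.MathematicalPhysics.QuantumFieldTheory.Balaban1983to89.B14.Eq372ContourBCH

open MatrixLog B7Eq31BCH

variable {𝔸 : Type*} [NormedRing 𝔸] [NormedAlgebra ℂ 𝔸] [CompleteSpace 𝔸]

/-! ## §1. The contour objects -/

/-- `(exp iB)(Γ)`: the ordered product `Π_{b⊂Γ} e^{X_b}` of the bond variables `e^{X_b}` (`X_b = iB(b)`, orientation signs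
absorbed) along the contour `Γ`, listed in contour order. [cite: Balaban1988Convergent, (3.71)–(3.72) p.284] -/
def holonomy (l : List 𝔸) : 𝔸 := (l.map exp).prod

/-- **(3.71)/(3.72), the contour variable** `B(Γ) = Σ_{b⊂Γ} B(b)` (additive reading of the contour; for a configuration
of the form `exp iB` this is `(1/i) log` of the holonomy to leading order). [cite: Balaban1988Convergent, (3.71)–(3.72) p.284] -/
def contourVar (l : List 𝔸) : 𝔸 := l.sum

/-- `Σ_{b,b′⊂Γ, b<b′} [X_b, X_{b′}]` in contour order — the second-order term of (3.72) (before the factor `½`).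
[cite: Balaban1988Convergent, (3.72) p.284] -/
def pairComm : List 𝔸 → 𝔸
  | [] => 0
  | X :: t => (X * t.sum - t.sum * X) + pairComm t

/-- The total size `Σ_{b⊂Γ} ‖X_b‖` of the contour variables (in print `O(|Γ|·LʲL⁻ⁿ·…)` by (3.68)).
[cite: Balaban1988Convergent, (3.68), (3.72) p.284] -/
def normSum (l : List 𝔸) : ℝ := (l.map fun X => ‖X‖).sum

omit [NormedAlgebra ℂ 𝔸] [CompleteSpace 𝔸] in
/-- `Σ‖X_b‖ ≥ 0`. [cite: Balaban1988Convergent, (3.72) p.284] -/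
theorem normSum_nonneg (l : List 𝔸) : 0 ≤ normSum l := by
  induction l with
  | nil => simp [normSum]
  | cons X t ih => simp only [normSum, List.map_cons, List.sum_cons] at ih ⊢; positivity

omit [NormedAlgebra ℂ 𝔸] [CompleteSpace 𝔸] in
/-- `normSum (X :: t) = ‖X‖ + normSum t`. [cite: Balaban1988Convergent, (3.72) p.284] -/
@[simp] theorem normSum_cons (X : 𝔸) (t : List 𝔸) : normSum (X :: t) = ‖X‖ + normSum t := by
  simp [normSum]

omit [NormedAlgebra ℂ 𝔸] [CompleteSpace 𝔸] in
/-- `‖B(Γ)‖ ≤ Σ_b ‖B(b)‖`. [cite: Balaban1988Convergent, (3.72) p.284] -/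
theorem norm_contourVar_le (l : List 𝔸) : ‖contourVar l‖ ≤ normSum l := by
  induction l with
  | nil => simp [contourVar, normSum]
  | cons X t ih =>
      simp only [contourVar, List.sum_cons, normSum_cons] at ih ⊢
      exact (norm_add_le _ _).trans (by linarith)

omit [NormedAlgebra ℂ 𝔸] [CompleteSpace 𝔸] in
/-- `‖XW − WX‖ ≤ 2‖X‖‖W‖`. [folklore] -/
private theorem norm_comm_le (X W : 𝔸) : ‖X * W - W * X‖ ≤ 2 * ‖X‖ * ‖W‖ := by
  calc ‖X * W - W * X‖ ≤ ‖X * W‖ + ‖W * X‖ := norm_sub_le _ _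
    _ ≤ ‖X‖ * ‖W‖ + ‖W‖ * ‖X‖ := add_le_add (norm_mul_le _ _) (norm_mul_le _ _)
    _ = 2 * ‖X‖ * ‖W‖ := by ring

omit [NormedAlgebra ℂ 𝔸] [CompleteSpace 𝔸] in
/-- `‖Σ_{b<b′}[X_b, X_{b′}]‖ ≤ (Σ_b ‖X_b‖)²`. [cite: Balaban1988Convergent, (3.72) p.284] -/
theorem norm_pairComm_le (l : List 𝔸) : ‖pairComm l‖ ≤ normSum l ^ 2 := by
  induction l with
  | nil => simp [pairComm, normSum]
  | cons X t ih =>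
      simp only [pairComm, normSum_cons]
      have h1 : ‖X * t.sum - t.sum * X‖ ≤ 2 * ‖X‖ * normSum t :=
        (norm_comm_le X t.sum).trans (by
          have := norm_contourVar_le t
          simp only [contourVar] at this
          exact mul_le_mul_of_nonneg_left this (by positivity))
      have h0 := normSum_nonneg t
      calc ‖X * t.sum - t.sum * X + pairComm t‖ ≤ 2 * ‖X‖ * normSum t + normSum t ^ 2 :=
            (norm_add_le _ _).trans (add_le_add h1 ih)
        _ ≤ (‖X‖ + normSum t) ^ 2 := by nlinarith [norm_nonneg X]

omit [NormedAlgebra ℂ 𝔸] [CompleteSpace 𝔸] in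
/-- Radius bookkeeping for a product: `‖AW − 1‖ ≤ (‖A − 1‖ + 1)(‖W − 1‖ + 1) − 1`. [folklore] -/
private theorem norm_mul_sub_one_le (A W : 𝔸) :
    ‖A * W - 1‖ ≤ (‖A - 1‖ + 1) * (‖W - 1‖ + 1) - 1 := by
  have hid : A * W - 1 = (A - 1) * (W - 1) + ((A - 1) + (W - 1)) := by noncomm_ring
  rw [hid]
  calc ‖(A - 1) * (W - 1) + ((A - 1) + (W - 1))‖ ≤ ‖A - 1‖ * ‖W - 1‖ + (‖A - 1‖ + ‖W - 1‖) :=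
        (norm_add_le _ _).trans (add_le_add (norm_mul_le _ _) (norm_add_le _ _))
    _ = (‖A - 1‖ + 1) * (‖W - 1‖ + 1) - 1 := by ring

/-- `‖Π_b e^{X_b} − 1‖ ≤ e^{Σ_b ‖X_b‖} − 1` (the holonomy of a small contour field is close to `1`, so its logarithm (21) is
defined). [cite: Balaban1988Convergent, (3.72) p.284] -/
theorem norm_holonomy_sub_one_le (l : List 𝔸) :
    ‖holonomy l - 1‖ ≤ Real.exp (normSum l) - 1 := by
  induction l with
  | nil => simp [holonomy, normSum]
  | cons X t ih =>
      simp only [holonomy, List.map_cons, List.prod_cons, normSum_cons] at ih ⊢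
      have hX := Literature.Analysis.Calculus.norm_exp_sub_one_le X
      have h0 : 0 ≤ ‖(t.map exp).prod - 1‖ := norm_nonneg _
      calc ‖exp X * (t.map exp).prod - 1‖
          ≤ (‖exp X - 1‖ + 1) * (‖(t.map exp).prod - 1‖ + 1) - 1 := norm_mul_sub_one_le _ _
        _ ≤ (Real.exp ‖X‖) * (Real.exp (normSum t)) - 1 := by
            gcongr
            · linarith
            · linarith
        _ = Real.exp (‖X‖ + normSum t) - 1 := by rw [Real.exp_add]

/-! ## §2. The second-order BCH expansion along a contour -/

/-- The real-arithmetic step of the induction: with `x = ‖X‖`, `s = Σ_{t}‖·‖`, `x + s ≤ 1/20`, `z ≤ 4s`, `r ≤ 28s³`,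
`c ≤ s²`: `5(x²z + xz²) + r + x(c/2 + r) ≤ 28(x + s)³`. [folklore] -/
private theorem step_bound {x s z r c : ℝ} (hx : 0 ≤ x) (hs : 0 ≤ s) (hz0 : 0 ≤ z)
    (hsum : x + s ≤ 1 / 20) (hz : z ≤ 4 * s) (hr : r ≤ 28 * s ^ 3) (hc : c ≤ s ^ 2) :
    5 * (x ^ 2 * z + x * z ^ 2) + r + x * (c / 2 + r) ≤ 28 * (x + s) ^ 3 := by
  have h1 : x ^ 2 * z ≤ x ^ 2 * (4 * s) := mul_le_mul_of_nonneg_left hz (sq_nonneg x)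
  have h2 : x * z ^ 2 ≤ x * (4 * s) ^ 2 :=
    mul_le_mul_of_nonneg_left (pow_le_pow_left₀ hz0 hz 2) hx
  have h3 : x * (c / 2 + r) ≤ x * (s ^ 2 / 2 + 28 * s ^ 3) :=
    mul_le_mul_of_nonneg_left (by linarith) hx
  have hs20 : s ≤ 1 / 20 := by linarith
  have h4 : x * s ^ 3 ≤ x * s ^ 2 / 20 := by
    have : s ^ 3 ≤ s ^ 2 / 20 := by nlinarith [sq_nonneg s]
    nlinarith
  have hx3 : 0 ≤ x ^ 3 := by positivity
  have hx2s : 0 ≤ x ^ 2 * s := by positivity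
  have hxs2 : 0 ≤ x * s ^ 2 := by positivity
  nlinarith

/-- **The second-order Baker–Campbell–Hausdorff expansion along a contour** (the analytic content of (3.72)): for bond
variables `X_b` with `Σ_{b⊂Γ} ‖X_b‖ ≤ 1/20`,
`‖log(Π_{b⊂Γ} e^{X_b}) − Σ_b X_b − ½ Σ_{b<b′} [X_b, X_{b′}]‖ ≤ 28 (Σ_b ‖X_b‖)³` — by induction along the contour from the
two-factor estimate (30) of [Balaban1985Averaging] (`B7Eq31BCH.eq30_of_sum_le`). [cite: Balaban1988Convergent, (3.72) p.284] -/
theorem norm_mlog_holonomy_sub_le (l : List 𝔸) (h : normSum l ≤ 1 / 20) :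
    ‖mlog (holonomy l) - contourVar l - (2⁻¹ : ℂ) • pairComm l‖ ≤ 28 * normSum l ^ 3 := by
  induction l with
  | nil => simp [holonomy, contourVar, pairComm, normSum]
  | cons X t ih =>
      have hx0 : 0 ≤ ‖X‖ := norm_nonneg X
      have hs0 : 0 ≤ normSum t := normSum_nonneg t
      have hst : normSum t ≤ 1 / 20 := by rw [normSum_cons] at h; linarith
      have iht := ih hst
      -- the tail holonomy is close to 1, so it is the exponential of its logarithm `Z`
      have hP1 : ‖holonomy t - 1‖ ≤ 2 * normSum t := by
        refine (norm_holonomy_sub_one_le t).trans ?_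
        have h1 : |normSum t| ≤ 1 := by rw [abs_of_nonneg hs0]; linarith
        have h2 := Real.abs_exp_sub_one_le h1
        rw [abs_of_nonneg hs0] at h2
        exact (le_abs_self _).trans h2
      have hPlt : ‖holonomy t - 1‖ < 1 := by linarith
      have hPhalf : ‖holonomy t - 1‖ ≤ 1 / 2 := by linarith
      set Z : 𝔸 := mlog (holonomy t) with hZ
      have hexpZ : exp Z = holonomy t := exp_mlog hPlt
      have hZn : ‖Z‖ ≤ 4 * normSum t := (norm_mlog_le_two_mul hPhalf).trans (by linarith)
      -- the two-factor expansion (30) with explicit constant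
      have hXZ : ‖X‖ + ‖Z‖ ≤ 1 / 5 := by rw [normSum_cons] at h; linarith
      have h30 := eq30_of_sum_le hXZ
      -- algebra: the new remainder = ρ + R_t + ½[X, Z − Σ_t]
      have hhol : holonomy (X :: t) = exp X * exp Z := by
        simp only [holonomy, List.map_cons, List.prod_cons] at hexpZ ⊢
        rw [hexpZ]
      set ρ : 𝔸 := mlog (exp X * exp Z) - X - Z - (2⁻¹ : ℂ) • (X * Z - Z * X) with hρ
      set R : 𝔸 := Z - contourVar t - (2⁻¹ : ℂ) • pairComm t with hR
      have hid : mlog (holonomy (X :: t)) - contourVar (X :: t) - (2⁻¹ : ℂ) • pairComm (X :: t)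
          = ρ + R + (2⁻¹ : ℂ) • (X * (Z - t.sum) - (Z - t.sum) * X) := by
        rw [hhol]
        simp only [hρ, hR, contourVar, List.sum_cons, pairComm, mul_sub, sub_mul, smul_sub, smul_add]
        abel
      rw [hid]
      -- norms of the three pieces
      have hZS : Z - t.sum = (2⁻¹ : ℂ) • pairComm t + R := by
        simp only [hR, contourVar]; abel
      have hhalf : ‖(2⁻¹ : ℂ)‖ = 2⁻¹ := by simp
      have hC := norm_pairComm_le t
      have hRn : ‖R‖ ≤ 28 * normSum t ^ 3 := iht
      have hZSn : ‖Z - t.sum‖ ≤ normSum t ^ 2 / 2 + 28 * normSum t ^ 3 := by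
        rw [hZS]
        calc ‖(2⁻¹ : ℂ) • pairComm t + R‖ ≤ ‖(2⁻¹ : ℂ) • pairComm t‖ + ‖R‖ := norm_add_le _ _
          _ ≤ 2⁻¹ * normSum t ^ 2 + 28 * normSum t ^ 3 := by
              refine add_le_add ?_ hRn
              rw [norm_smul, hhalf]; exact mul_le_mul_of_nonneg_left hC (by norm_num)
          _ = normSum t ^ 2 / 2 + 28 * normSum t ^ 3 := by ring
      have h3 : ‖(2⁻¹ : ℂ) • (X * (Z - t.sum) - (Z - t.sum) * X)‖
          ≤ ‖X‖ * (normSum t ^ 2 / 2 + 28 * normSum t ^ 3) := by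
        rw [norm_smul, hhalf]
        calc 2⁻¹ * ‖X * (Z - t.sum) - (Z - t.sum) * X‖ ≤ 2⁻¹ * (2 * ‖X‖ * ‖Z - t.sum‖) :=
              mul_le_mul_of_nonneg_left (norm_comm_le _ _) (by norm_num)
          _ = ‖X‖ * ‖Z - t.sum‖ := by ring
          _ ≤ ‖X‖ * (normSum t ^ 2 / 2 + 28 * normSum t ^ 3) := mul_le_mul_of_nonneg_left hZSn hx0
      calc ‖ρ + R + (2⁻¹ : ℂ) • (X * (Z - t.sum) - (Z - t.sum) * X)‖
          ≤ ‖ρ‖ + ‖R‖ + ‖(2⁻¹ : ℂ) • (X * (Z - t.sum) - (Z - t.sum) * X)‖ :=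
            (norm_add_le _ _).trans (add_le_add (norm_add_le _ _) le_rfl)
        _ ≤ 5 * (‖X‖ ^ 2 * ‖Z‖ + ‖X‖ * ‖Z‖ ^ 2) + 28 * normSum t ^ 3
              + ‖X‖ * (normSum t ^ 2 / 2 + 28 * normSum t ^ 3) := add_le_add (add_le_add h30 hRn) h3
        _ ≤ 28 * (‖X‖ + normSum t) ^ 3 :=
            step_bound hx0 hs0 (norm_nonneg Z) (by rw [normSum_cons] at h; exact h) hZn le_rfl le_rfl
        _ = 28 * normSum (X :: t) ^ 3 := by rw [normSum_cons]

/-! ## §3. (3.72) in the printed letters: `X_b = iB(b)` -/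

/-- `Σ_{b<b′} i[B(b), B(b′)]` — the printed second-order term of (3.72) (before the factor `½`).
[cite: Balaban1988Convergent, (3.72) p.284] -/
def pairCommI (B : List 𝔸) : 𝔸 := Complex.I • pairComm B

omit [CompleteSpace 𝔸] in
/-- With `X_b = iB(b)`: `Σ_{b<b′}[X_b, X_{b′}] = −Σ_{b<b′}[B(b), B(b′)]` (`i² = −1`). [cite: Balaban1988Convergent, (3.72) p.284] -/
theorem pairComm_map_I_smul (B : List 𝔸) :
    pairComm (B.map fun b => Complex.I • b) = -pairComm B := by
  induction B with
  | nil => simp [pairComm]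
  | cons b t ih =>
      simp only [List.map_cons, pairComm, ih]
      rw [← List.smul_sum]
      simp only [smul_mul_assoc, mul_smul_comm, smul_smul, Complex.I_mul_I, neg_smul, one_smul]
      abel

omit [CompleteSpace 𝔸] in
/-- With `X_b = iB(b)`: `Σ_b X_b = i B(Γ)`. [cite: Balaban1988Convergent, (3.72) p.284] -/
theorem contourVar_map_I_smul (B : List 𝔸) :
    contourVar (B.map fun b => Complex.I • b) = Complex.I • contourVar B := by
  simp only [contourVar, List.smul_sum]

omit [CompleteSpace 𝔸] in
/-- `Σ_b ‖iB(b)‖ = Σ_b ‖B(b)‖`. [cite: Balaban1988Convergent, (3.72) p.284] -/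
theorem normSum_map_I_smul (B : List 𝔸) :
    normSum (B.map fun b => Complex.I • b) = normSum B := by
  induction B with
  | nil => simp [normSum]
  | cons b t ih =>
      simp only [List.map_cons, normSum_cons, norm_smul, Complex.norm_I, one_mul, ih]

/-- **(3.72)**: `(1/i) log(exp iB)(Γ) = B(Γ) + ½ Σ_{b<b′⊂Γ} i[B(b), B(b′)] + O(1)(Σ_b |B(b)|)³` — for bond variables `B(b)` in
a complete normed `ℂ`-algebra with `Σ_{b⊂Γ} ‖B(b)‖ ≤ 1/20`, the remainder is at most `28 (Σ_b ‖B(b)‖)³` in norm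
(`(1/i)·` = `(−i)•`, `log` = the series (21) of [12]). [cite: Balaban1988Convergent, (3.72) p.284] -/
theorem eq372 (B : List 𝔸) (h : normSum B ≤ 1 / 20) :
    ‖(-Complex.I) • mlog (holonomy (B.map fun b => Complex.I • b))
        - (contourVar B + (2⁻¹ : ℂ) • pairCommI B)‖ ≤ 28 * normSum B ^ 3 := by
  have hmain := norm_mlog_holonomy_sub_le (B.map fun b => Complex.I • b) (by rw [normSum_map_I_smul]; exact h)
  rw [normSum_map_I_smul, contourVar_map_I_smul, pairComm_map_I_smul] at hmain
  have hid : (-Complex.I) • mlog (holonomy (B.map fun b => Complex.I • b))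
        - (contourVar B + (2⁻¹ : ℂ) • pairCommI B)
      = (-Complex.I) • (mlog (holonomy (B.map fun b => Complex.I • b)) - Complex.I • contourVar B
          - (2⁻¹ : ℂ) • (-pairComm B)) := by
    simp only [pairCommI, smul_sub, smul_neg, smul_smul, neg_mul, Complex.I_mul_I, neg_neg, one_smul]
    module
  rw [hid, norm_smul, norm_neg, Complex.norm_I, one_mul]
  exact hmain

end Literature.MathematicalPhysics.QuantumFieldTheory.Balaban1983to89.B14.Eq372ContourBCH
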